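import Mathlib
import HarnessLib
import Summits.ValiantsHypothesis.ValiantsHypothesis.Theses.MonotoneRestoration
import Literature.Computability.AlgebraicComplexity.ArithCircuit
import Literature.Computability.AlgebraicComplexity.ArithCircuitProofs
import Literature.Computability.AlgebraicComplexity.MonotoneStructure
import Literature.Computability.AlgebraicComplexity.PermanentIrreducible
import Literature.ModelTheory.FiniteModelTheory.CkEquiv
import Summits.ValiantsHypothesis.ValiantsHypothesis.Theorems.MonotoneRestorationMonotoneRestorationQPCosetCount
import Summits.ValiantsHypothesis.ValiantsHypothesis.Theorems.MonotoneRestorationMonotoneRestorationQPSymmetricLB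
import Summits.ValiantsHypothesis.ValiantsHypothesis.Theorems.MonotoneRestorationMonotoneRestorationQPSupportSymmetrisation
import Summits.ValiantsHypothesis.ValiantsHypothesis.Theorems.MonotoneRestorationMonotoneRestorationQPSparseRegime
import Summits.ValiantsHypothesis.ValiantsHypothesis.Theorems.MonotoneRestorationMonotoneRestorationQPBeta
import Literature.Computability.AlgebraicComplexity.SymmetricArithCircuit
import Literature.Computability.AlgebraicComplexity.DawarWilsenach2025Proofs
import Literature.GroupTheory.PermutationGroups.SmallIndexSubgroups
import Summits.ValiantsHypothesis.ValiantsHypothesis.Theorems.MonotoneRestorationQP.Negative.LoadBearing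
import Summits.ValiantsHypothesis.ValiantsHypothesis.Theorems.MonotoneRestorationMonotoneRestorationQPPermSupportCount

/-! TTRL-lite variant V19345 of stmt-ValiantsHypothesis-15886

No cancellation at a `+` gate over `ℝ≥0`: in a labelled arithmetic circuit over `NNReal`, every
monomial of a child `h` of an addition gate `g` is a monomial of `g` (the coefficient of the sum
vanishes only if every summand's coefficient vanishes, `Finset.sum_eq_zero_iff` in the canonically
ordered semiring `ℝ≥0`). Hence if every monomial of `eval g`, shifted by a context `μ`, lies in the
support of `f`, the same holds for every monomial of `eval h` — the `+` case of the "used gate"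
induction.
-/

-- `Summit.ValiantsHypothesis.ValiantsHypothesis.…` is the tree's mandated single-conjunct layout
-- (Sub = Summit), so the duplicated namespace component is intended.
set_option linter.dupNamespace false

namespace Summit.ValiantsHypothesis.ValiantsHypothesis.Theorems

open Summit.ValiantsHypothesis.ValiantsHypothesis.Theses.MonotoneRestoration
open Literature.Computability.AlgebraicComplexity

/-- **TTRL-lite variant V19345 of `stub_symmetricMonotone_choose_le_card`** (no cancellation at a
`+` gate over `ℝ≥0`). If `g` is an addition gate of a labelled arithmetic circuit over `NNReal`
and `h` is one of its children, then every monomial of `C.eval h` is a monomial of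
`C.eval g = ∑_{h' ∈ children g} C.eval h'` (a sum of nonnegative coefficients vanishes only when
each does); consequently the "context" property `∀ m ∈ support (eval g), m + μ ∈ support f`
descends from `g` to `h` with the same `μ`.
[cite: DawarWilsenach2025, §2 (evaluation of `+` gates)] -/
theorem stub_symmetricMonotone_choose_le_card_var19345 :
    ∀ (n : ℕ) (G : Type) (C : LabelledArithCircuit NNReal (Fin n × Fin n) Unit G)
      (f : MvPolynomial (Fin n × Fin n) NNReal) (g h : G) (μ : Fin n × Fin n →₀ ℕ),
      C.label g = CircuitLabel.add → h ∈ C.children g →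
      (∀ m ∈ (C.eval g).support, m + μ ∈ f.support) →
      ∀ m ∈ (C.eval h).support, m + μ ∈ f.support := by
  intro n G C f g h μ hg hh hsupp m hm
  refine hsupp m ?_
  rw [C.eval_of_label_add hg, MvPolynomial.mem_support_iff, MvPolynomial.coeff_sum]
  rw [MvPolynomial.mem_support_iff] at hm
  intro hzero
  exact hm (Finset.sum_eq_zero_iff.mp hzero h hh)

end Summit.ValiantsHypothesis.ValiantsHypothesis.Theorems
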